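import Summits.PneNP.PneNP.Theorems.SliceACZero.Negative.QuantifierOrder
import Literature.Computability.Complexity.CliqueCounting
import Literature.Computability.Complexity.GnpSprinkling

/-!
# `SliceACZero` (stmt-PneNP-2835) — negative-side lemmas III: the accuracy `δ` must shrink with the
# clique size `k` (first moments on the central slice and at the central density)

* `sliceCard_eq` (`#slice_j = C(C(n,2), j)`), `card_slice_supset_le`, `card_slice_clique_le`,
  `choose_sub_mul_pow_le_choose_mul_pow`, `choose_mul_ratio_pow_le`, `firstMoment_slice`: on a slice
  `C(k,2) ≤ j ≤ C(n,2)`, `j ≤ C(n,2)·n^{-2/(k-1)}`, at most a `1/k!`-fraction of the graphs carry a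
  `k`-clique (slice analogue of the in-tree `gnpProb_clique_le`; usable by provers as one half of the
  Poisson window on the slice).
* `not_innerConc_of_factorial_inv_le`, `not_innerHyp_of_factorial_inv_le`: for `d ≥ 1`, every `c`,
  `k ≥ 2` and `δ ≥ 1/k!` the inner clauses are false (constant-`0` circuit `∨₀`); so every witness has
  `δ < 1/k!` (`lt_factorial_inv_of_innerConc`, `lt_factorial_inv_of_innerHyp`).
* `not_concDeltaFirst`, `not_hypDeltaFirst`: the quantifier order `∀ d ∃ δ ∀ c ∃ k` is false (given
  `δ`, take `c = ⌈1/δ⌉₊`; `k ≤ c` dies by the clique DNF of `QuantifierOrder.lean`, `k > c` by the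
  constant circuit).

Refuter seat cdisprove-stmt-PneNP-2835 (gen 1), 2026-08-16. In the docstrings, `InnerConc d c k δ` /
`InnerHyp d c k δ` (and their `NoWindow`/`NoBasis`/… variants) denote the displayed inner clauses; they are
named predicates only in the work file `Summits/PneNP/PneNP/Cruxes/SliceACZero/Disproof.lean` (running
commentary: why the crux resists, what was not attempted) and are INLINED here.
-/

noncomputable section

namespace Summit.PneNP.PneNP.Theorems.SliceACZero.Negative

open Literature.Computability.Complexity Filter Finset
open Summit.PneNP.PneNP.Theses.OneSlice (SliceACZero)

/-! ## Part IV — `δ` must shrink with `k`: first moments on the central slice / at the central density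

The accuracy parameter cannot be chosen before the clique size: for `d ≥ 1`, every `c`, `k ≥ 2` and
every `δ ≥ 1/k!` the inner clauses are FALSE, witnessed by the one-gate constant circuit `∨₀ = 0`
(`not_innerConc_of_factorial_inv_le`, `not_innerHyp_of_factorial_inv_le`): on the central slice
`j = m_k(n)` (resp. at the central density `q = m_k(n)/C(n,2)`) the fraction of graphs with a
`k`-clique is at most `C(n,k) (j/C(n,2))^{C(k,2)} ≤ (n^k/k!) · n^{-k} = 1/k!` (first moment; on the
slice through the exact count `#{x : |x| = j, K_A ⊆ x} = C(N - C(k,2), j - C(k,2))` and the ratio bound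
`C(N-K, j-K) N^K ≤ C(N,j) j^K`). Hence every witness `(k, δ)` has `δ < 1/k!`
(`lt_factorial_inv_of_innerConc`), and the strengthenings with the quantifier order `∃ δ ∀ c ∃ k`
are false (`not_concDeltaFirst`, `not_hypDeltaFirst`: given `δ`, take `c = ⌈1/δ⌉₊`; a witness
`k ≤ c` is killed by the clique DNF of Part II, a witness `k > c` by the constant circuit).
`firstMoment_slice` is the slice analogue of the in-tree `gnpProb_clique_le` and may serve provers
(it is one half of the Poisson window `Pr_j[k-clique] → 1 - e^{-1/k!}`). -/

section Moment

variable {n : ℕ}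

/-- The support (set of switched-on edges) of an edge vector. [folklore] -/
def supp (x : (⊤ : SimpleGraph (Fin n)).edgeSet → Bool) : Finset ((⊤ : SimpleGraph (Fin n)).edgeSet) :=
  univ.filter fun e => x e = true

/-- Membership in the support. [folklore] -/
theorem mem_supp {x : (⊤ : SimpleGraph (Fin n)).edgeSet → Bool}
    {e : (⊤ : SimpleGraph (Fin n)).edgeSet} : e ∈ supp x ↔ x e = true := by
  simp [supp]

/-- The support has `e(x)` elements (definitional). [folklore] -/
theorem card_supp (x : (⊤ : SimpleGraph (Fin n)).edgeSet → Bool) : #(supp x) = edgeCount x := rfl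

/-- An edge vector is determined by its support. [folklore] -/
theorem supp_injective : Function.Injective (supp (n := n)) := by
  intro x y h
  funext e
  have he : e ∈ supp x ↔ e ∈ supp y := by rw [h]
  rw [mem_supp, mem_supp] at he
  exact Bool.eq_iff_iff.2 he

/-- The indicator vector of an edge set has that set as support. [folklore] -/
theorem supp_indicator (s : Finset ((⊤ : SimpleGraph (Fin n)).edgeSet)) :
    supp (fun e => decide (e ∈ s)) = s := by
  ext e
  simp [supp]

/-- **Size of a slice**: `#{x : e(x) = j} = C(C(n,2), j)`. [folklore] -/
theorem sliceCard_eq (n j : ℕ) : sliceCard n j = (n.choose 2).choose j := by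
  rw [← card_edgeSet_top_fin n, ← Finset.card_univ, ← Finset.card_powersetCard]
  refine Finset.card_bij (fun x _ => supp x) ?_ ?_ ?_
  · intro x hx
    rw [Finset.mem_powersetCard]
    exact ⟨Finset.subset_univ _, (Finset.mem_filter.1 hx).2⟩
  · intro x _ y _ h
    exact supp_injective h
  · intro s hs
    refine ⟨fun e => decide (e ∈ s), ?_, supp_indicator s⟩
    rw [Finset.mem_filter]
    refine ⟨Finset.mem_univ _, ?_⟩
    rw [← card_supp, supp_indicator]
    exact (Finset.mem_powersetCard.1 hs).2

/-- **Slice vectors containing a fixed edge set**: at most `C(N - |S|, j - |S|)` vectors with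
exactly `j` edges switch on every edge of `S` (`|S| ≤ j`; Mathlib's
`Finset.card_filter_powersetCard_subset` through the support bijection). [folklore] -/
theorem card_slice_supset_le (j : ℕ) (S : Finset ((⊤ : SimpleGraph (Fin n)).edgeSet))
    (hSj : #S ≤ j) :
    #(univ.filter fun x : (⊤ : SimpleGraph (Fin n)).edgeSet → Bool =>
        edgeCount x = j ∧ ∀ e ∈ S, x e = true) ≤ (n.choose 2 - #S).choose (j - #S) := by
  set P : ((⊤ : SimpleGraph (Fin n)).edgeSet → Bool) → Prop := fun x =>
    edgeCount x = j ∧ ∀ e ∈ S, x e = true with hP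
  have h1 : #(univ.filter P) = #((univ.filter P).image supp) :=
    (Finset.card_image_of_injective _ supp_injective).symm
  have h2 : (univ.filter P).image supp ⊆
      ((univ : Finset ((⊤ : SimpleGraph (Fin n)).edgeSet)).powersetCard j).filter fun Q => S ⊆ Q := by
    intro s hs
    rw [Finset.mem_image] at hs
    obtain ⟨x, hx, rfl⟩ := hs
    rw [Finset.mem_filter] at hx ⊢
    obtain ⟨-, hj, hS⟩ := hx
    exact ⟨Finset.mem_powersetCard.2 ⟨Finset.subset_univ _, hj⟩, fun e he => mem_supp.2 (hS e he)⟩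
  rw [h1]
  refine (Finset.card_le_card h2).trans ?_
  have := card_filter_supset_powersetCard_le (univ : Finset ((⊤ : SimpleGraph (Fin n)).edgeSet)) S hSj
  rwa [Finset.card_univ, card_edgeSet_top_fin] at this

/-- A graph with a `k`-clique has at least `C(k,2)` edges. [folklore] -/
theorem choose_le_edgeCount_of_cliqueFn {k : ℕ} {x : (⊤ : SimpleGraph (Fin n)).edgeSet → Bool}
    (hx : cliqueFn n k x = true) : k.choose 2 ≤ edgeCount x := by
  have hne := (cliqueCount_ne_zero_iff x).2 hx
  rw [Ne, cliqueCount_eq_zero_iff_forall] at hne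
  push Not at hne
  obtain ⟨A, hA, hAx⟩ := hne
  rw [← (Finset.mem_powersetCard.1 hA).2, ← card_filter_cliqueVec A, ← card_supp]
  exact Finset.card_le_card fun e he => mem_supp.2 (hAx e (Finset.mem_filter.1 he).2)

/-- **Union bound on the slice**: the vectors with exactly `j ≥ C(k,2)` edges carrying a `k`-clique
number at most `C(n,k) · C(C(n,2) - C(k,2), j - C(k,2))`. [folklore] -/
theorem card_slice_clique_le (j k : ℕ) (hKj : k.choose 2 ≤ j) :
    #(univ.filter fun x : (⊤ : SimpleGraph (Fin n)).edgeSet → Bool =>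
        edgeCount x = j ∧ cliqueFn n k x = true) ≤
      n.choose k * (n.choose 2 - k.choose 2).choose (j - k.choose 2) := by
  set T := powersetCard k (univ : Finset (Fin n)) with hT
  set F : Finset (Fin n) → Finset ((⊤ : SimpleGraph (Fin n)).edgeSet → Bool) := fun A =>
    univ.filter fun x => edgeCount x = j ∧
      ∀ e ∈ univ.filter (fun e : (⊤ : SimpleGraph (Fin n)).edgeSet => cliqueVec A e = true),
        x e = true with hF
  have hsub : (univ.filter fun x : (⊤ : SimpleGraph (Fin n)).edgeSet → Bool =>
      edgeCount x = j ∧ cliqueFn n k x = true) ⊆ T.biUnion F := by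
    intro x hx
    rw [Finset.mem_filter] at hx
    obtain ⟨-, hj, hcl⟩ := hx
    have hne := (cliqueCount_ne_zero_iff x).2 hcl
    rw [Ne, cliqueCount_eq_zero_iff_forall] at hne
    push Not at hne
    obtain ⟨A, hA, hAx⟩ := hne
    rw [Finset.mem_biUnion]
    refine ⟨A, hA, ?_⟩
    rw [hF, Finset.mem_filter]
    exact ⟨Finset.mem_univ _, hj, fun e he => hAx e (Finset.mem_filter.1 he).2⟩
  have hFle : ∀ A ∈ T, #(F A) ≤ (n.choose 2 - k.choose 2).choose (j - k.choose 2) := by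
    intro A hA
    have hcard : #(univ.filter fun e : (⊤ : SimpleGraph (Fin n)).edgeSet => cliqueVec A e = true) =
        k.choose 2 := by
      rw [card_filter_cliqueVec, (Finset.mem_powersetCard.1 hA).2]
    have h := card_slice_supset_le j
      (univ.filter fun e : (⊤ : SimpleGraph (Fin n)).edgeSet => cliqueVec A e = true) (hcard ▸ hKj)
    rw [hcard] at h
    exact h
  calc _ ≤ #(T.biUnion F) := Finset.card_le_card hsub
    _ ≤ ∑ A ∈ T, #(F A) := Finset.card_biUnion_le
    _ ≤ ∑ A ∈ T, (n.choose 2 - k.choose 2).choose (j - k.choose 2) := Finset.sum_le_sum hFle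
    _ = n.choose k * (n.choose 2 - k.choose 2).choose (j - k.choose 2) := by
        rw [Finset.sum_const, hT, Finset.card_powersetCard, Finset.card_univ, Fintype.card_fin,
          smul_eq_mul]

/-- **Ratio bound** `C(N-K, j-K) · N^K ≤ C(N, j) · j^K` for `K ≤ j ≤ N` ("the probability that a
uniform `j`-set contains a fixed `K`-set is at most `(j/N)^K`"). [folklore] -/
theorem choose_sub_mul_pow_le_choose_mul_pow {N j K : ℕ} (hKj : K ≤ j) (hjN : j ≤ N) :
    (N - K).choose (j - K) * N ^ K ≤ N.choose j * j ^ K := by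
  have h1 : N.choose j * j.choose K = N.choose K * (N - K).choose (j - K) := Nat.choose_mul hKj
  have h2 := choose_mul_pow_le_choose_mul_pow hjN K
  have hKN : K ≤ N := hKj.trans hjN
  have h3 : (N - K).choose (j - K) * N ^ K * N.choose K ≤ N.choose j * j ^ K * N.choose K := by
    calc (N - K).choose (j - K) * N ^ K * N.choose K
        = (N.choose j * j.choose K) * N ^ K := by rw [h1]; ring
      _ = N.choose j * (j.choose K * N ^ K) := by ring
      _ ≤ N.choose j * (N.choose K * j ^ K) := Nat.mul_le_mul_left _ h2
      _ = N.choose j * j ^ K * N.choose K := by ring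
  exact Nat.le_of_mul_le_mul_right h3 (Nat.choose_pos hKN)

/-- **Threshold arithmetic**: `C(n,k) · (j/C(n,2))^{C(k,2)} ≤ 1/k!` whenever
`j ≤ C(n,2) · n^{-2/(k-1)}` (as `(n^{-2/(k-1)})^{C(k,2)} = n^{-k}` and `C(n,k) ≤ n^k/k!`). [folklore] -/
theorem choose_mul_ratio_pow_le {n k j : ℕ} (hk : 2 ≤ k) (hn : 1 ≤ n) (hN : 0 < n.choose 2)
    (hjm : (j : ℝ) ≤ (n.choose 2 : ℕ) * (n : ℝ) ^ (-(2 : ℝ) / ((k : ℝ) - 1))) :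
    (n.choose k : ℝ) * ((j : ℝ) / (n.choose 2 : ℕ)) ^ (k.choose 2) ≤ 1 / (k.factorial : ℝ) := by
  have hNr : (0 : ℝ) < (n.choose 2 : ℕ) := by exact_mod_cast hN
  have hn0 : (0 : ℝ) ≤ n := Nat.cast_nonneg _
  have hnpos : (0 : ℝ) < n := by exact_mod_cast hn
  have hratio : (j : ℝ) / (n.choose 2 : ℕ) ≤ (n : ℝ) ^ (-(2 : ℝ) / ((k : ℝ) - 1)) := by
    rw [div_le_iff₀ hNr, mul_comm]
    exact hjm
  have hratio0 : 0 ≤ (j : ℝ) / (n.choose 2 : ℕ) := div_nonneg (Nat.cast_nonneg _) hNr.le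
  have hpow : ((j : ℝ) / (n.choose 2 : ℕ)) ^ (k.choose 2) ≤
      ((n : ℝ) ^ (-(2 : ℝ) / ((k : ℝ) - 1))) ^ (k.choose 2) :=
    pow_le_pow_left₀ hratio0 hratio _
  have hexp : ((n : ℝ) ^ (-(2 : ℝ) / ((k : ℝ) - 1))) ^ (k.choose 2) = ((n : ℝ) ^ k)⁻¹ := by
    rw [← Real.rpow_mul_natCast hn0, Nat.cast_choose_two]
    have hk1 : (k : ℝ) - 1 ≠ 0 := by
      have : (2 : ℝ) ≤ k := by exact_mod_cast hk
      linarith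
    have : -(2 : ℝ) / ((k : ℝ) - 1) * ((k : ℝ) * ((k : ℝ) - 1) / 2) = -(k : ℝ) := by
      field_simp
    rw [this, Real.rpow_neg hn0, Real.rpow_natCast]
  have hchoose : (n.choose k : ℝ) ≤ (n : ℝ) ^ k / (k.factorial : ℝ) := by
    have := Nat.choose_le_pow_div k n (α := ℝ)
    simpa using this
  have hnk : (0 : ℝ) < (n : ℝ) ^ k := pow_pos hnpos k
  calc (n.choose k : ℝ) * ((j : ℝ) / (n.choose 2 : ℕ)) ^ (k.choose 2)
      ≤ ((n : ℝ) ^ k / k.factorial) * ((n : ℝ) ^ k)⁻¹ := by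
        rw [← hexp]
        exact mul_le_mul hchoose hpow (pow_nonneg hratio0 _)
          (div_nonneg (pow_nonneg hn0 _) (Nat.cast_nonneg _))
    _ = 1 / k.factorial := by
        field_simp

/-- **First moment on the slice at the threshold**: if `C(k,2) ≤ j ≤ C(n,2)` and
`j ≤ C(n,2) · n^{-2/(k-1)}`, then at most a `1/k!`-fraction of the graphs with exactly `j` edges
have a `k`-clique (slice analogue of the in-tree `gnpProb_clique_le`). [folklore] -/
theorem firstMoment_slice {k j : ℕ} (hk : 2 ≤ k) (hn : 1 ≤ n) (hKj : k.choose 2 ≤ j)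
    (hjN : j ≤ n.choose 2)
    (hjm : (j : ℝ) ≤ (n.choose 2 : ℕ) * (n : ℝ) ^ (-(2 : ℝ) / ((k : ℝ) - 1))) :
    (#(univ.filter fun x : (⊤ : SimpleGraph (Fin n)).edgeSet → Bool =>
        edgeCount x = j ∧ cliqueFn n k x = true) : ℝ) ≤ 1 / (k.factorial : ℝ) * sliceCard n j := by
  have hK1 : 0 < k.choose 2 := Nat.choose_pos hk
  have hN : 0 < n.choose 2 := by omega
  have hNr : (0 : ℝ) < (n.choose 2 : ℕ) := by exact_mod_cast hN
  have hcomb := card_slice_clique_le (n := n) j k hKj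
  have hratio := choose_sub_mul_pow_le_choose_mul_pow (K := k.choose 2) hKj hjN
  have hratio' : (((n.choose 2 - k.choose 2).choose (j - k.choose 2) : ℕ) : ℝ) ≤
      ((n.choose 2).choose j : ℕ) * ((j : ℝ) / (n.choose 2 : ℕ)) ^ (k.choose 2) := by
    rw [div_pow, ← mul_div_assoc, le_div_iff₀ (pow_pos hNr _)]
    exact_mod_cast hratio
  calc (#(univ.filter fun x : (⊤ : SimpleGraph (Fin n)).edgeSet → Bool =>
          edgeCount x = j ∧ cliqueFn n k x = true) : ℝ)
      ≤ (n.choose k : ℝ) * (((n.choose 2 - k.choose 2).choose (j - k.choose 2) : ℕ) : ℝ) := by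
        exact_mod_cast hcomb
    _ ≤ (n.choose k : ℝ) * (((n.choose 2).choose j : ℕ) * ((j : ℝ) / (n.choose 2 : ℕ)) ^ (k.choose 2)) :=
        mul_le_mul_of_nonneg_left hratio' (Nat.cast_nonneg _)
    _ = ((n.choose k : ℝ) * ((j : ℝ) / (n.choose 2 : ℕ)) ^ (k.choose 2)) *
          ((n.choose 2).choose j : ℕ) := by ring
    _ ≤ 1 / (k.factorial : ℝ) * ((n.choose 2).choose j : ℕ) :=
        mul_le_mul_of_nonneg_right (choose_mul_ratio_pow_le hk hn hN hjm) (Nat.cast_nonneg _)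
    _ = 1 / (k.factorial : ℝ) * sliceCard n j := by rw [sliceCard_eq]

/-- The slice error of the constant-`0` circuit against `k`-CLIQUE counts the clique vectors of the
slice. [folklore] -/
theorem sliceErr_const_false (j k : ℕ) :
    sliceErr n j (Circuit.const _ false).eval (cliqueFn n k) =
      #(univ.filter fun x : (⊤ : SimpleGraph (Fin n)).edgeSet → Bool =>
        edgeCount x = j ∧ cliqueFn n k x = true) := by
  unfold sliceErr
  congr 1
  refine Finset.filter_congr fun x _ => ?_
  rw [Circuit.eval_const, ne_comm, Bool.ne_false_iff]

/-- The `G(n,q)`-error of the constant-`0` circuit against `k`-CLIQUE is `Pr[k-clique]`. [folklore] -/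
theorem gnpDisagreeProb_const_false (q : ℝ) (k : ℕ) :
    gnpDisagreeProb n q (Circuit.const _ false).eval (cliqueFn n k) =
      ∑ x ∈ univ.filter (fun x : (⊤ : SimpleGraph (Fin n)).edgeSet → Bool => cliqueFn n k x = true),
        gnpWeight n q x := by
  rw [gnpDisagreeProb]
  refine Finset.sum_congr ?_ fun _ _ => rfl
  refine Finset.filter_congr fun x _ => ?_
  rw [Circuit.eval_const, ne_comm, Bool.ne_false_iff]

/-- **`δ ≥ 1/k!` is impossible in `Conc`** (`d ≥ 1`, every `c`, `k ≥ 2`): on the central slice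
`j = m_k(n)` the constant-`0` circuit (one `∨₀` gate, size `1`, `acDepth 1`) errs on at most a
`1/k!`-fraction; `n ^ c < 1` is false. So every witness `(k, δ)` of `Conc` has `δ < 1/k!`.
[folklore] -/
theorem not_innerConc_of_factorial_inv_le {d : ℕ} (hd : 1 ≤ d) (c : ℕ) {k : ℕ} (hk : 2 ≤ k)
    {δ : ℝ} (hδ : 1 / (k.factorial : ℝ) ≤ δ) : ¬ (∀ᶠ n : ℕ in atTop, ∀ j : ℕ, |(j : ℝ) - (mk n k : ℝ)| ≤ (mk n k : ℝ) ^ ((3 : ℝ) / 4) →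
        ∀ C : Circuit ((⊤ : SimpleGraph (Fin n)).edgeSet), C.IsOver acBasis → C.acDepth ≤ d →
          (sliceErr n j C.eval (cliqueFn n k) : ℝ) ≤ δ * sliceCard n j → n ^ c < C.size) := by
  intro h
  obtain ⟨n, hn, hn1⟩ := (h.and (eventually_ge_atTop 1)).exists
  have hδ0 : 0 ≤ δ := (by positivity : (0 : ℝ) ≤ 1 / (k.factorial : ℝ)).trans hδ
  have herr : (sliceErr n (mk n k) (Circuit.const _ false).eval (cliqueFn n k) : ℝ) ≤
      δ * sliceCard n (mk n k) := by
    rw [sliceErr_const_false]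
    by_cases hKm : k.choose 2 ≤ mk n k
    · calc _ ≤ 1 / (k.factorial : ℝ) * sliceCard n (mk n k) :=
            firstMoment_slice hk hn1 hKm (mk_le_choose hn1 hk) (Nat.floor_le (by positivity))
        _ ≤ δ * sliceCard n (mk n k) := mul_le_mul_of_nonneg_right hδ (Nat.cast_nonneg _)
    · have h0 : #(univ.filter fun x : (⊤ : SimpleGraph (Fin n)).edgeSet → Bool =>
          edgeCount x = mk n k ∧ cliqueFn n k x = true) = 0 := by
        rw [Finset.card_eq_zero, Finset.filter_eq_empty_iff]
        rintro x - ⟨hj, hcl⟩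
        exact hKm (hj ▸ choose_le_edgeCount_of_cliqueFn hcl)
      rw [h0, Nat.cast_zero]
      exact mul_nonneg hδ0 (Nat.cast_nonneg _)
  have hlt := hn (mk n k) (centre_count n k) (Circuit.const _ false)
    (Circuit.const_isOver_acBasis false) (by rw [Circuit.acDepth_const]; exact hd) herr
  rw [Circuit.size_const] at hlt
  exact absurd (Nat.one_le_pow c n hn1) (not_le.2 hlt)

/-- **`δ ≥ 1/k!` is impossible in `Hyp`** likewise, at the central density (through the in-tree
first moment `gnpProb_clique_le`). [folklore] -/
theorem not_innerHyp_of_factorial_inv_le {d : ℕ} (hd : 1 ≤ d) (c : ℕ) {k : ℕ} (hk : 2 ≤ k)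
    {δ : ℝ} (hδ : 1 / (k.factorial : ℝ) ≤ δ) : ¬ (∀ᶠ n : ℕ in atTop, ∀ q : ℝ, 0 ≤ q → q ≤ 1 →
        |q * (n.choose 2 : ℕ) - (mk n k : ℝ)| ≤ (mk n k : ℝ) ^ ((3 : ℝ) / 4) →
        ∀ C : Circuit ((⊤ : SimpleGraph (Fin n)).edgeSet), C.IsOver acBasis → C.acDepth ≤ d →
          gnpDisagreeProb n q C.eval (cliqueFn n k) ≤ δ → n ^ c < C.size) := by
  intro h
  obtain ⟨n, hn, hn2⟩ := (h.and (eventually_ge_atTop 2)).exists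
  obtain ⟨hq0, hq1, hqw⟩ := centre_density hn2 hk
  have hN : 0 < n.choose 2 := Nat.choose_pos hn2
  have herr : gnpDisagreeProb n ((mk n k : ℝ) / (n.choose 2 : ℕ)) (Circuit.const _ false).eval
      (cliqueFn n k) ≤ δ := by
    rw [gnpDisagreeProb_const_false]
    refine (gnpProb_clique_le hq0 hq1 k).trans ?_
    exact (choose_mul_ratio_pow_le hk (by omega) hN (Nat.floor_le (by positivity))).trans hδ
  have hlt := hn _ hq0 hq1 hqw (Circuit.const _ false) (Circuit.const_isOver_acBasis false)
    (by rw [Circuit.acDepth_const]; exact hd) herr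
  rw [Circuit.size_const] at hlt
  exact absurd (Nat.one_le_pow c n (by omega)) (not_le.2 hlt)

/-- Every witness `(k, δ)` of `Conc` (at `d ≥ 1`, `k ≥ 2`) has `δ < 1/k!`. [folklore] -/
theorem lt_factorial_inv_of_innerConc {d c k : ℕ} (hd : 1 ≤ d) (hk : 2 ≤ k) {δ : ℝ}
    (h : (∀ᶠ n : ℕ in atTop, ∀ j : ℕ, |(j : ℝ) - (mk n k : ℝ)| ≤ (mk n k : ℝ) ^ ((3 : ℝ) / 4) →
        ∀ C : Circuit ((⊤ : SimpleGraph (Fin n)).edgeSet), C.IsOver acBasis → C.acDepth ≤ d →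
          (sliceErr n j C.eval (cliqueFn n k) : ℝ) ≤ δ * sliceCard n j → n ^ c < C.size)) : δ < 1 / (k.factorial : ℝ) :=
  lt_of_not_ge fun hδ => not_innerConc_of_factorial_inv_le hd c hk hδ h

/-- Every witness `(k, δ)` of `Hyp` (at `d ≥ 1`, `k ≥ 2`) has `δ < 1/k!`. [folklore] -/
theorem lt_factorial_inv_of_innerHyp {d c k : ℕ} (hd : 1 ≤ d) (hk : 2 ≤ k) {δ : ℝ}
    (h : (∀ᶠ n : ℕ in atTop, ∀ q : ℝ, 0 ≤ q → q ≤ 1 →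
        |q * (n.choose 2 : ℕ) - (mk n k : ℝ)| ≤ (mk n k : ℝ) ^ ((3 : ℝ) / 4) →
        ∀ C : Circuit ((⊤ : SimpleGraph (Fin n)).edgeSet), C.IsOver acBasis → C.acDepth ≤ d →
          gnpDisagreeProb n q C.eval (cliqueFn n k) ≤ δ → n ^ c < C.size)) : δ < 1 / (k.factorial : ℝ) :=
  lt_of_not_ge fun hδ => not_innerHyp_of_factorial_inv_le hd c hk hδ h

/-- If `k > ⌈1/δ⌉₊` then `1/k! ≤ δ`. [folklore] -/
theorem factorial_inv_le_of_ceil_lt {δ : ℝ} (hδ : 0 < δ) {k : ℕ} (hk : ⌈1 / δ⌉₊ < k) :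
    1 / (k.factorial : ℝ) ≤ δ := by
  have hk0 : (0 : ℝ) < k := by exact_mod_cast (Nat.zero_le _).trans_lt hk
  have h1 : 1 / δ < k := (Nat.le_ceil _).trans_lt (by exact_mod_cast hk)
  have h2 : 1 / (k : ℝ) < δ := (one_div_lt hδ hk0).1 h1
  have h3 : 1 / (k.factorial : ℝ) ≤ 1 / (k : ℝ) :=
    one_div_le_one_div_of_le hk0 (by exact_mod_cast Nat.self_le_factorial k)
  exact h3.trans h2.le

/-- **`δ` cannot be chosen before `k` in `Conc`**: the quantifier order `∀ d ∃ δ ∀ c ∃ k` is false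
(`d = 2`; given `δ` take `c = ⌈1/δ⌉₊`: a witness `k ≤ c` is killed by the clique DNF, a witness
`k > c` has `1/k! ≤ δ` and is killed by the constant circuit). [folklore] -/
theorem not_concDeltaFirst :
    ¬ ∀ d : ℕ, ∃ δ : ℝ, 0 < δ ∧ ∀ c : ℕ, ∃ k : ℕ, 3 ≤ k ∧ (∀ᶠ n : ℕ in atTop, ∀ j : ℕ, |(j : ℝ) - (mk n k : ℝ)| ≤ (mk n k : ℝ) ^ ((3 : ℝ) / 4) →
        ∀ C : Circuit ((⊤ : SimpleGraph (Fin n)).edgeSet), C.IsOver acBasis → C.acDepth ≤ d →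
          (sliceErr n j C.eval (cliqueFn n k) : ℝ) ≤ δ * sliceCard n j → n ^ c < C.size) := by
  intro h
  obtain ⟨δ, hδ, hc⟩ := h 2
  obtain ⟨k, hk3, hI⟩ := hc ⌈1 / δ⌉₊
  by_cases hkc : k ≤ ⌈1 / δ⌉₊
  · exact not_innerConc_of_le le_rfl (by omega) hkc hδ.le hI
  · exact not_innerConc_of_factorial_inv_le (by norm_num) _ (by omega)
      (factorial_inv_le_of_ceil_lt hδ (not_le.1 hkc)) hI

/-- **`δ` cannot be chosen before `k` in `Hyp`** (same argument at the central density). [folklore] -/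
theorem not_hypDeltaFirst :
    ¬ ∀ d : ℕ, ∃ δ : ℝ, 0 < δ ∧ ∀ c : ℕ, ∃ k : ℕ, 3 ≤ k ∧ (∀ᶠ n : ℕ in atTop, ∀ q : ℝ, 0 ≤ q → q ≤ 1 →
        |q * (n.choose 2 : ℕ) - (mk n k : ℝ)| ≤ (mk n k : ℝ) ^ ((3 : ℝ) / 4) →
        ∀ C : Circuit ((⊤ : SimpleGraph (Fin n)).edgeSet), C.IsOver acBasis → C.acDepth ≤ d →
          gnpDisagreeProb n q C.eval (cliqueFn n k) ≤ δ → n ^ c < C.size) := by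
  intro h
  obtain ⟨δ, hδ, hc⟩ := h 2
  obtain ⟨k, hk3, hI⟩ := hc ⌈1 / δ⌉₊
  by_cases hkc : k ≤ ⌈1 / δ⌉₊
  · exact not_innerHyp_of_le le_rfl (by omega) hkc hδ.le hI
  · exact not_innerHyp_of_factorial_inv_le (by norm_num) _ (by omega)
      (factorial_inv_le_of_ceil_lt hδ (not_le.1 hkc)) hI

end Moment

end Summit.PneNP.PneNP.Theorems.SliceACZero.Negative

end
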